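import Literature.NumberTheory.Sieve.HeathBrownCubicApproxAssembly
import Literature.NumberTheory.Sieve.HeathBrownCubicPrimesFrontier
import Literature.NumberTheory.Sieve.HeathBrownMorozClassFamily
import HarnessLib

/-!
# Heath-Brown–Moroz 2004, Lemmas 3.2–3.3 (= Heath-Brown's Lemmas 3.6, 3.7 for the class family), I

D. R. Heath-Brown and B. Z. Moroz, *On the representation of primes by cubic polynomials in two
variables*, Proc. LMS (3) 88 (2004) 289–312 [HeathBrownMoroz2004], §3 p. 18 of the render: "Neither the
formulation, nor the proof of the analogues of [3, Lemmata 3.6 and 3.7] need be changed. … **Lemma 3.2**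
We have `S_j(𝒜) + κS_j(ℬ) ≪ τη²X²/log X` for `j = 3, 5, 6` or `7`. **Lemma 3.3** We have
`∑_{n≥3}|U^(n)(𝒟) − Û^(n)(𝒟)| ≪ ξτ^{-4}η²X²/log X`, …" for the class sequence `𝒜` (the tree's
`CubicSieve.classPairs`, `HeathBrownMorozClassFamily`).

In the tree both lemmas of [3] = [HeathBrownActa2001] are PROVED for the full family `𝒜^(K)`
(`HeathBrown2001_lemma_3_6_holds`, `S4_A_bound`, `U_A_bounds`, `U2_A_bound`) from the corrected Lemma 7.1
through GENERIC family inequalities (`S4_bound_of_h7`, `U_sum_bound`, `U2_bound_of_h7`) whose family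
inputs — the sifting functions `S_K(𝒵_Q, z)` (`famSifted`), the counts `#𝒵_R` (`famCount`) and the raw
error counts — are all MONOTONE in the family. Hence the class versions follow for every SUBFAMILY
`E' ⊆ 𝒜^(K)` with the same constants, which is how this file and its sequel (`HeathBrownMorozClassApprox`)
prove them. Contents:

* monotonicity: `famSifted_mono`, `famSiftedAbove_mono`, `famCount_mono`, `primeRangeSum_mono`,
  `UpieceWhere_mono`, `S₃/S₅/S₆/S₇_mono`;
* **`HeathBrownMoroz2004_lemma_3_2`** — Lemma 3.6 of [3] for any subfamily `E' ⊆ 𝒜^(K)` and any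
  `0 ≤ κ' ≤ K·κ` (for the class: `κ_d = (w(d)/d²)κ ≤ w(d)κ`), from `HeathBrown2001_lemma_3_6_holds`;
* `h7_of_subfamily` — the `𝒜`-half of the corrected Lemma 7.1 transferred to a subfamily;
* **`S4_sub_bound`**, **`U2_sub_bound`** — the `S₄`- and `U₂^(1)`-lines of Lemma 3.7 of [3] for any
  subfamily of `𝒜^(K)` (the `U`-lines and the assembly are in the sequel).

## References

* [HeathBrownMoroz2004] §3, Lemmas 3.2 and 3.3, p. 18. [cite: HeathBrownMoroz2004, Lemma 3.2]
* [HeathBrownActa2001] D. R. Heath-Brown, Acta Math. 186 (2001), Lemmas 3.6, 3.7, §7 pp. 39–47.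
  [cite: HeathBrownActa2001, Lemma 3.7]

## Mathlib / tree search

Tree: `HeathBrown2001_lemma_3_6_holds` (`HeathBrownCubicPrimesFrontier`), `S4_bound_of_h7`,
`absNorm_pairIdeal_bounds`, `eventually_le_hbTau_mul_log`, `hbXi_div_pow_four`, `absorb_le`, `rpow_two_sub`
(`HeathBrownCubicApproxS4`), `U2_bound_of_h7`, `eventually_U2_params`, `rpow_tau_bounds`, `sqDefect_A_le`,
`sqDefect_A_absorb`, `one_le_eta_mul` (`HeathBrownCubicApproxU2Bounds`), `E1_A_eq_zero` (`…ApproxUA`),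
`famCount_boxPairs`, `countA_eq_zero_of_not_prime`, `countA_eq_zero_of_absNorm_eq`,
`eventually_upperBound_params`, `exists_sum_normWt_window_le`, `ten_le_log` (`HeathBrownCubicUpperBoundTools`),
`HeathBrown2001_lemma_7_1_normWeighted_holds` (`HeathBrownCubicPrimesFrontier`), `classPairs_subset_boxPairs`,
`classKappa` (`HeathBrownMorozClassFamily`).
-/

noncomputable section

open Polynomial NumberField Finset Filter Topology Asymptotics
open scoped nonZeroDivisors

namespace Literature.NumberTheory.Sieve.CubicSieve

open LFunctions.CubeRootTwoField CubicPrimes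
open Literature.NumberTheory.LFunctions (idealNormCount)

/-! ### Monotonicity of the sieve pieces in the family -/

section Mono

variable {ι : Type*} {E' E : Finset ι} (I : ι → Ideal (𝓞 K))

/-- `S_K` is monotone in the family. [cite: HeathBrownActa2001, §3 p. 11] -/
theorem famSifted_mono (h : E' ⊆ E) (R : Ideal (𝓞 K)) (z : ℝ) :
    famSifted E' I R z ≤ famSifted E I R z := by
  classical
  unfold famSifted; exact card_le_card (filter_subset_filter _ h)

/-- `S_K^≺` is monotone in the family. [cite: HeathBrownActa2001, §3 (3.1)] -/
theorem famSiftedAbove_mono (h : E' ⊆ E) (R P : Ideal (𝓞 K)) :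
    famSiftedAbove E' I R P ≤ famSiftedAbove E I R P := by
  classical
  unfold famSiftedAbove; exact card_le_card (filter_subset_filter _ h)

/-- `#𝒵_R` is monotone in the family. [cite: HeathBrownActa2001, §3 p. 11] -/
theorem famCount_mono (h : E' ⊆ E) (R : Ideal (𝓞 K)) : famCount E' I R ≤ famCount E I R := by
  classical
  unfold famCount; exact card_le_card (filter_subset_filter _ h)

/-- `∑_{a ≤ N P < b} S_K^≺(𝒵_P, P)` is monotone in the family. [cite: HeathBrownActa2001, §3 p. 12] -/
theorem primeRangeSum_mono (h : E' ⊆ E) (a b : ℝ) :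
    primeRangeSum E' I a b ≤ primeRangeSum E I a b :=
  sum_le_sum fun P _ => famSiftedAbove_mono I h P P

/-- `UpieceWhere` is monotone in the family. [cite: HeathBrownActa2001, §3 p. 13] -/
theorem UpieceWhere_mono (h : E' ⊆ E) (X τ : ℝ) (n : ℕ) (c : ℝ → Prop) :
    UpieceWhere E' I X τ n c ≤ UpieceWhere E I X τ n c := by
  classical
  unfold UpieceWhere; exact sum_le_sum fun sP _ => famSiftedAbove_mono I h _ _

/-- `S₃, S₅, S₆, S₇` are monotone in the family. [cite: HeathBrownActa2001, §3 pp. 12–13] -/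
theorem S3567_mono (h : E' ⊆ E) (X τ : ℝ) :
    S₃ E' I X τ ≤ S₃ E I X τ ∧ S₅ E' I X τ ≤ S₅ E I X τ ∧ S₆ E' I X τ ≤ S₆ E I X τ ∧
      S₇ E' I X τ ≤ S₇ E I X τ :=
  ⟨primeRangeSum_mono I h _ _, primeRangeSum_mono I h _ _, UpieceWhere_mono I h X τ 1 _,
    UpieceWhere_mono I h X τ 2 _⟩

end Mono

/-! ### Lemma 3.6 for subfamilies (Heath-Brown–Moroz's Lemma 3.2) -/

/-- **Heath-Brown–Moroz 2004, Lemma 3.2** (= [3, Lemma 3.6] for the class): for every subfamily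
`E' ⊆ 𝒜^(K)` and every comparison constant `0 ≤ κ' ≤ K·κ` (`κ = σ₀η/(3X)`; the class uses
`κ_d = (w(d)/d²)κ`), `S_j(E') + κ'S_j(ℬ) ≤ (1 + K)·C·τη²X²/log X` for `j = 3, 5, 6, 7`, with `C, X₀` those of
the tree's Lemma 3.6 — by monotonicity in the family. [cite: HeathBrownMoroz2004, Lemma 3.2] -/
theorem HeathBrownMoroz2004_lemma_3_2 :
    ∀ σ₀ : ℝ, Tendsto singularProductPartial atTop (𝓝 σ₀) → ∀ ϖ : ℝ, 0 < ϖ → ϖ < 1 / 5 →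
      ∀ K : ℝ, 0 ≤ K → ∃ C X₀ : ℝ, ∀ X η : ℝ, X₀ ≤ X → Real.exp (-Real.log X ^ (1 / 3 : ℝ)) ≤ η → η ≤ 1 →
        ∀ E' : Finset (ℕ × ℕ), E' ⊆ boxPairs X η → ∀ κ' : ℝ, 0 ≤ κ' → κ' ≤ K * kappa σ₀ X η →
          ((S₃ E' pairIdeal X (hbTau ϖ X) : ℝ) + κ' * S₃ (normWindow X η) (fun J => J) X (hbTau ϖ X) ≤
              C * hbTau ϖ X * η ^ 2 * X ^ 2 / Real.log X) ∧
          ((S₅ E' pairIdeal X (hbTau ϖ X) : ℝ) + κ' * S₅ (normWindow X η) (fun J => J) X (hbTau ϖ X) ≤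
              C * hbTau ϖ X * η ^ 2 * X ^ 2 / Real.log X) ∧
          ((S₆ E' pairIdeal X (hbTau ϖ X) : ℝ) + κ' * S₆ (normWindow X η) (fun J => J) X (hbTau ϖ X) ≤
              C * hbTau ϖ X * η ^ 2 * X ^ 2 / Real.log X) ∧
          ((S₇ E' pairIdeal X (hbTau ϖ X) : ℝ) + κ' * S₇ (normWindow X η) (fun J => J) X (hbTau ϖ X) ≤
              C * hbTau ϖ X * η ^ 2 * X ^ 2 / Real.log X) := by
  intro σ₀ hσ ϖ hϖ0 hϖ1 K hK
  have hσ0 : 0 ≤ σ₀ := ge_of_tendsto' hσ fun N => (singularProductPartial_pos N).le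
  obtain ⟨C, X₀, h⟩ := HeathBrown2001_lemma_3_6_holds σ₀ hσ ϖ hϖ0 hϖ1
  refine ⟨(1 + K) * C, max X₀ 1, fun X η hX hη hη1 E' hE' κ' hκ'0 hκ' => ?_⟩
  have hX0 : X₀ ≤ X := le_trans (le_max_left _ _) hX
  have hX1 : (0 : ℝ) ≤ X := le_trans zero_le_one (le_trans (le_max_right _ _) hX)
  have hη0 : 0 ≤ η := (Real.exp_pos _).le.trans hη
  obtain ⟨h3, h5, h6, h7⟩ := h X η hX0 hη hη1
  obtain ⟨m3, m5, m6, m7⟩ := S3567_mono pairIdeal hE' X (hbTau ϖ X)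
  have hκ : 0 ≤ kappa σ₀ X η := by rw [kappa_def]; positivity
  set B := C * hbTau ϖ X * η ^ 2 * X ^ 2 / Real.log X with hB
  -- generic step: `a' + κ' b ≤ (1+K)(a + κ b)` when `a' ≤ a`, `κ' ≤ Kκ`, everything nonnegative
  have step : ∀ (a' a b : ℝ), 0 ≤ a' → a' ≤ a → 0 ≤ b → a + kappa σ₀ X η * b ≤ B →
      a' + κ' * b ≤ (1 + K) * C * hbTau ϖ X * η ^ 2 * X ^ 2 / Real.log X := by
    intro a' a b ha' hle hb hbound
    have ha : 0 ≤ a := ha'.trans hle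
    have hB0 : 0 ≤ B := le_trans (add_nonneg ha (mul_nonneg hκ hb)) hbound
    have h1 : κ' * b ≤ K * (kappa σ₀ X η * b) := by
      calc κ' * b ≤ (K * kappa σ₀ X η) * b := mul_le_mul_of_nonneg_right hκ' hb
        _ = K * (kappa σ₀ X η * b) := by ring
    have h2 : kappa σ₀ X η * b ≤ B := le_trans (by linarith) hbound
    have h3 : a' ≤ B := by nlinarith
    calc a' + κ' * b ≤ B + K * B := by nlinarith
      _ = (1 + K) * C * hbTau ϖ X * η ^ 2 * X ^ 2 / Real.log X := by rw [hB]; ring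
  refine ⟨step _ _ _ (Nat.cast_nonneg _) (by exact_mod_cast m3) (Nat.cast_nonneg _) h3,
    step _ _ _ (Nat.cast_nonneg _) (by exact_mod_cast m5) (Nat.cast_nonneg _) h5,
    step _ _ _ (Nat.cast_nonneg _) (by exact_mod_cast m6) (Nat.cast_nonneg _) h6,
    step _ _ _ (Nat.cast_nonneg _) (by exact_mod_cast m7) (Nat.cast_nonneg _) h7⟩

/-- `κ_d ≤ w(d)·κ` (`d ≥ 1`) and `κ_d ≥ 0`: the class constant is within the scope of
`HeathBrownMoroz2004_lemma_3_2` with `K = w(d)`. [cite: HeathBrownMoroz2004, §3 (3.1)] -/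
theorem classKappa_le {σ₀ X η : ℝ} (hσ : 0 ≤ σ₀) (hX : 0 ≤ X) (hη : 0 ≤ η) {d : ℕ} (hd : 1 ≤ d) :
    0 ≤ classKappa σ₀ X η d ∧ classKappa σ₀ X η d ≤ classWeight d * kappa σ₀ X η := by
  refine ⟨classKappa_nonneg hσ hX hη d, ?_⟩
  rw [classKappa_def]
  have hκ : 0 ≤ kappa σ₀ X η := by rw [kappa_def]; positivity
  have hw := classWeight_pos d
  have hd1 : (1 : ℝ) ≤ (d : ℝ) ^ 2 := one_le_pow₀ (by exact_mod_cast hd)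
  have : classWeight d / (d : ℝ) ^ 2 ≤ classWeight d := div_le_self hw.le hd1
  exact mul_le_mul_of_nonneg_right this hκ

/-! ### The `𝒜`-half of the corrected Lemma 7.1 for a subfamily -/

/-- **Lemma 7.1 (corrected, `𝒜`-half) for a subfamily `E' ⊆ 𝒜^(K)`**: the sifting functions of `E'`
are dominated by those of `𝒜^(K)` (`famSifted_mono`, `siftedA_eq_famSifted`), so the conclusion of
`HeathBrown2001_lemma_7_1_normWeighted` at `(X, η)` transfers with any larger constant `C₇' ≥ C₇`.
[cite: HeathBrownActa2001, Lemma 7.1] -/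
theorem h7_of_subfamily {X η τ C₇ C₇' : ℝ} {E' : Finset (ℕ × ℕ)} (hE' : E' ⊆ boxPairs X η)
    (hX1 : 1 < X) (hτ0 : 0 < τ) (hCC : C₇ ≤ C₇')
    (h7X : ∀ (N z : ℝ) (𝒬 : Finset ℕ), X ^ τ ≤ z → 0 < N → N ≤ X ^ (2 - 2 * τ) →
      (∀ q ∈ 𝒬, Squarefree q ∧ N < q ∧ (q : ℝ) ≤ 2 * N) →
      (∑ Q ∈ normIn 𝒬, (siftedA X η Q z : ℝ)) ≤
        C₇ * (η ^ 2 * X ^ 2 / Real.log (min z (X ^ (2 - τ) / N)) *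
          ∑ Q ∈ normIn 𝒬, ((Ideal.absNorm Q : ℕ) : ℝ)⁻¹ + X ^ (2 - τ / 5))) :
    ∀ (N z : ℝ) (𝒬 : Finset ℕ), X ^ τ ≤ z → 0 < N → N ≤ X ^ (2 - 2 * τ) →
      (∀ q ∈ 𝒬, Squarefree q ∧ N < q ∧ (q : ℝ) ≤ 2 * N) →
      ∑ Q ∈ normIn 𝒬, (famSifted E' pairIdeal Q z : ℝ) ≤
        C₇' * (η ^ 2 * X ^ 2 / Real.log (min z (X ^ (2 - τ) / N)) *
          ∑ Q ∈ normIn 𝒬, ((Ideal.absNorm Q : ℕ) : ℝ)⁻¹ + X ^ (2 - τ / 5)) := by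
  intro N z 𝒬 hz hN hNX h𝒬
  have hX0 : 0 < X := by linarith
  have h := h7X N z 𝒬 hz hN hNX h𝒬
  simp_rw [siftedA_eq_famSifted] at h
  have hmono : ∑ Q ∈ normIn 𝒬, (famSifted E' pairIdeal Q z : ℝ) ≤
      ∑ Q ∈ normIn 𝒬, (famSifted (boxPairs X η) pairIdeal Q z : ℝ) :=
    sum_le_sum fun Q _ => by exact_mod_cast famSifted_mono pairIdeal hE' Q z
  refine hmono.trans (h.trans (mul_le_mul_of_nonneg_right hCC ?_))
  have hlogmin : 0 ≤ Real.log (min z (X ^ (2 - τ) / N)) := by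
    refine Real.log_nonneg ?_
    have hz1 : 1 ≤ z := le_trans (Real.one_le_rpow hX1.le hτ0.le) hz
    have h2 : 1 ≤ X ^ (2 - τ) / N := by
      rw [le_div_iff₀ hN, one_mul]
      exact hNX.trans (Real.rpow_le_rpow_of_exponent_le hX1.le (by linarith))
    exact le_min hz1 h2
  have : 0 ≤ ∑ Q ∈ normIn 𝒬, ((Ideal.absNorm Q : ℕ) : ℝ)⁻¹ := sum_nonneg fun _ _ => by positivity
  positivity

/-- For a subfamily of `𝒜^(K)`, `#𝒵_R = 0` whenever `#𝒜^(K)_R = 0`. [cite: HeathBrownActa2001, Lemma 3.1] -/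
theorem famCount_sub_eq_zero {X η : ℝ} {E' : Finset (ℕ × ℕ)} (hE' : E' ⊆ boxPairs X η) {R : Ideal (𝓞 K)}
    (h : countA X η R = 0) : famCount E' pairIdeal R = 0 := by
  have := famCount_mono pairIdeal hE' R
  rw [famCount_boxPairs, h] at this
  exact Nat.le_zero.mp this

/-! ### Lemma 3.7 for subfamilies: the `S₄`- and `U₂^(1)`-lines -/

/-- **Lemma 3.7, `S₄`-line, for every subfamily `E' ⊆ 𝒜^(K)`** (Heath-Brown–Moroz's Lemma 3.3 for
`|S₄(𝒜) − Ŝ₄(𝒜)|`): `|S₄(E') − Ŝ₄(E')| ≤ C ξτ^{-4} η²X²/log X` for `X ≥ X₀`, `η` in (2.1), with `C, X₀`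
independent of `E'` (proof = the tree's `S4_A_bound` with the family inputs dominated by those of `𝒜^(K)`).
[cite: HeathBrownMoroz2004, Lemma 3.3] [cite: HeathBrownActa2001, Lemma 3.7] -/
theorem S4_sub_bound {ϖ : ℝ} (hϖ0 : 0 < ϖ) (hϖ1 : ϖ < 1 / 5) :
    ∃ C X₀ : ℝ, ∀ X η : ℝ, X₀ ≤ X → Real.exp (-Real.log X ^ (1 / 3 : ℝ)) ≤ η → η ≤ 1 →
      ∀ E' : Finset (ℕ × ℕ), E' ⊆ boxPairs X η →
      |(S₄ E' pairIdeal X (hbTau ϖ X) : ℝ) - S4hat X (hbTau ϖ X) E' pairIdeal| ≤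
        C * (hbXi (hbTau ϖ X) / hbTau ϖ X ^ 4) * (η ^ 2 * X ^ 2 / Real.log X) := by
  classical
  obtain ⟨C₇, X₇, h7⟩ := HeathBrown2001_lemma_7_1_normWeighted_holds ϖ hϖ0 hϖ1
  obtain ⟨C₁, hC₁, hwin⟩ := exists_sum_normWt_window_le
  have hϖ1' : ϖ ≤ 1 := by linarith
  set C₇' : ℝ := max C₇ 1 with hC₇'
  have hC₇'0 : 0 ≤ C₇' := le_trans zero_le_one (le_max_right _ _)
  have hCC : C₇ ≤ C₇' := le_max_left _ _
  obtain ⟨X₁, hX₁⟩ := Filter.eventually_atTop.mp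
    ((eventually_upperBound_params hϖ0 hϖ1' one_pos 3).and
      ((eventually_le_hbTau_mul_log hϖ1' 4).and (eventually_ge_atTop (max X₇ ((2 : ℝ) ^ 15)))))
  refine ⟨C₇' * (29 + 10 * C₁), X₁, fun X η hX hη hη1 E' hE' => ?_⟩
  obtain ⟨⟨-, hτ0, hτ8, hlogτ, habs⟩, hτL, hXmax⟩ := hX₁ X hX
  set τ := hbTau ϖ X with hτdef
  have hX15 : (2 : ℝ) ^ 15 ≤ X := le_trans (le_max_right _ _) hXmax
  have hX7 : X₇ ≤ X := le_trans (le_max_left _ _) hXmax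
  have hX1 : 1 < X := lt_of_lt_of_le (by norm_num) hX15
  have hX0 : 0 < X := by linarith
  set L := Real.log X with hL
  have hL10 : 10 ≤ L := ten_le_log hX15
  have hη0 : 0 < η := lt_of_lt_of_le (Real.exp_pos _) hη
  have hE : ∀ xy ∈ E', pairIdeal xy ≠ ⊥ ∧ X ^ 3 < (Ideal.absNorm (pairIdeal xy) : ℝ) ∧
      (Ideal.absNorm (pairIdeal xy) : ℝ) ≤ 24 * X ^ 3 := fun xy hxy =>
    ⟨pairIdeal_ne_bot_of_mem_boxPairs hX0.le xy (hE' hxy), absNorm_pairIdeal_bounds hX0 hη1 (hE' hxy)⟩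
  have hCN : (24 : ℝ) < X ^ (3 * τ) := by
    have h1 : Real.exp 12 ≤ X ^ (3 * τ) := by
      rw [Real.rpow_def_of_pos hX0, ← hL]
      exact Real.exp_le_exp.mpr (by nlinarith)
    have h2 : (24 : ℝ) < Real.exp 12 := by
      have he : (2 : ℝ) < Real.exp 1 := by have := Real.exp_one_gt_d9; linarith
      have h3 : Real.exp 12 = Real.exp 1 ^ 12 := by
        rw [← Real.exp_nat_mul]; norm_num
      rw [h3]
      calc (24 : ℝ) < 2 ^ 12 := by norm_num
        _ ≤ Real.exp 1 ^ 12 := pow_le_pow_left₀ (by norm_num) he.le 12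
    linarith
  set D := (Literature.NumberTheory.LFunctions.NumberField.finite_primeIdealsLE K (24 * X ^ 2)).toFinset.filter
    fun R₀ => ¬ (Ideal.absNorm R₀).Prime ∧ X ^ (1 + τ) ≤ (Ideal.absNorm R₀ : ℝ) with hD
  have hDmem : ∀ R₀ ∈ D, R₀.IsPrime ∧ R₀ ≠ ⊥ ∧ ¬ (Ideal.absNorm R₀).Prime := by
    intro R₀ hR₀
    simp only [hD, mem_filter, Set.Finite.mem_toFinset,
      Literature.NumberTheory.LFunctions.NumberField.primeIdealsLE, Set.mem_setOf_eq] at hR₀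
    exact ⟨hR₀.1.1, hR₀.1.2.1, hR₀.2.1⟩
  have hD0 : ∀ R₀ ∈ D, R₀ ≠ ⊥ := fun R₀ hR₀ => (hDmem R₀ hR₀).2.1
  have hDin : ∀ R₀ : Ideal (𝓞 K), R₀.IsPrime → R₀ ≠ ⊥ → ¬ (Ideal.absNorm R₀).Prime →
      X ^ (1 + τ) ≤ (Ideal.absNorm R₀ : ℝ) → (Ideal.absNorm R₀ : ℝ) ≤ 24 * X ^ 2 → R₀ ∈ D := by
    intro R₀ h1 h2 h3 h4 h5
    simp only [hD, mem_filter, Set.Finite.mem_toFinset,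
      Literature.NumberTheory.LFunctions.NumberField.primeIdealsLE, Set.mem_setOf_eq]
    exact ⟨⟨h1, h2, h5⟩, h3, h4⟩
  have h7A := h7_of_subfamily hE' hX1 hτ0 hCC
    (fun N z 𝒬 hz hN hNX h𝒬 => (h7 X η hX7 hη hη1 N z 𝒬 hz hN hNX h𝒬).1)
  have hmain := S4_bound_of_h7 E' pairIdeal hX15 hτ0 hτ8 hlogτ hCN (by norm_num) hE D hD0 hDin
    hC₇'0 (by positivity) (by positivity) hC₁ hwin h7A
  have hT1 : ∑ P ∈ (primesNormIco (X ^ (1 + τ)) (X ^ (3 / 2 - τ))).filter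
      (fun P => ¬ (Ideal.absNorm P).Prime), (famCount E' pairIdeal P : ℝ) = 0 := by
    refine sum_eq_zero fun P hP => ?_
    rw [mem_filter, mem_primesNormIco_iff] at hP
    rw [famCount_sub_eq_zero hE' (countA_eq_zero_of_not_prime hP.1.1 hP.1.2.1 (dvd_refl P) hP.2),
      Nat.cast_zero]
  have hT3 : ∑ R₀ ∈ D, (famCount E' pairIdeal R₀ : ℝ) = 0 := by
    refine sum_eq_zero fun R₀ hR₀ => ?_
    obtain ⟨h1, h2, h3⟩ := hDmem R₀ hR₀
    rw [famCount_sub_eq_zero hE' (countA_eq_zero_of_not_prime h1 h2 (dvd_refl R₀) h3), Nat.cast_zero]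
  rw [hT1, hT3, zero_add, zero_add] at hmain
  have hη2 : Real.exp (-2 * Real.log X ^ (1 / 3 : ℝ)) ≤ η ^ 2 := by
    have : Real.exp (-2 * Real.log X ^ (1 / 3 : ℝ)) = Real.exp (-Real.log X ^ (1 / 3 : ℝ)) ^ 2 := by
      rw [← Real.exp_nat_mul]; ring_nf
    rw [this]
    exact pow_le_pow_left₀ (Real.exp_pos _).le hη 2
  have habs' : X ^ (-τ / 5) * L ^ 3 ≤ τ * η ^ 2 / L := by
    rw [one_mul] at habs
    refine habs.trans ?_
    rw [hL]
    exact div_le_div_of_nonneg_right (mul_le_mul_of_nonneg_left hη2 hτ0.le) (by linarith)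
  have herr : 9 * C₇' * X ^ (2 - τ / 5) * L ≤ 9 * C₇' * (τ * η ^ 2 * X ^ 2 / L) := by
    have h := absorb_le (T := 9 * C₇') (δ := τ / 5) (j := 1) hX1.le (by linarith) (by positivity)
      le_rfl (by norm_num) habs'
    have e : X ^ (2 - τ / 5) = X ^ 2 * X ^ (-(τ / 5)) := rpow_two_sub hX0 (τ / 5)
    rw [pow_one] at h
    calc 9 * C₇' * X ^ (2 - τ / 5) * L = 9 * C₇' * (X ^ 2 * X ^ (-(τ / 5)) * L) := by rw [e]; ring
      _ ≤ _ := h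
  have hscale : hbXi τ / τ ^ 4 = τ := hbXi_div_pow_four hτ0.ne'
  rw [hscale]
  have hfinal : C₇' * (20 + 10 * C₁) * (τ * (η ^ 2 * X ^ 2) / L) + 9 * C₇' * (τ * η ^ 2 * X ^ 2 / L) =
      C₇' * (29 + 10 * C₁) * τ * (η ^ 2 * X ^ 2 / L) := by ring
  calc _ ≤ C₇' * (20 + 10 * C₁) * (τ * (η ^ 2 * X ^ 2) / L) + 9 * C₇' * X ^ (2 - τ / 5) * L := hmain
    _ ≤ C₇' * (20 + 10 * C₁) * (τ * (η ^ 2 * X ^ 2) / L) + 9 * C₇' * (τ * η ^ 2 * X ^ 2 / L) := by linarith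
    _ = C₇' * (29 + 10 * C₁) * τ * (η ^ 2 * X ^ 2 / L) := hfinal

end Literature.NumberTheory.Sieve.CubicSieve

end
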